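import Summits.QuantumFields.BalabanUV.T4Continuum.Support.NE7SliceRepresentativeDbar
import Summits.QuantumFields.BalabanUV.T4Continuum.Support.NE7DbarQbarLetters
import HarnessLib

/-!
# NE7SliceDirectLettersNL0 — (S2)-NL0: THE TWO DIRECT LETTERS OF THE COARSE DATUM AT A STATE WITH (1.37) EXACTLY (the fixed point of the (R1″) frame-free engine
# `NE7SliceTheoremNL0`), k-FREE: `(M^d∕M⁴)·dirL1 φ̃(u) [0,N)^d ≤ q₁·‖X(u)‖_w²`, `(M^d∕M⁴)·dirSq φ̃(u) [0,N)^d ≤ q₂²·‖X(u)‖_w²`, `q₁ = 64C₁L²d(4L+1)^d·(L^d∕L²)`,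
# `q₂² = 1024K²(L^d∕L⁴)·(M·b)²` (memo ROAD-G103 §6, END step (C4)-2)

Cell `pub-balaban`, rung (B)+1 sub-cell t4, lineage `b2b-balaban-t4-ne7-p1`, generation 103 (CRUX PROVER NE7 #1 = OWNER of BINDER row NE7).  Memo `t4/b2b-balaban-t4-ne7-p1-g103/ROAD-G103.md` §6.
PURE COMPOSITION of two landed files of this lineage: `NE7SliceRepresentativeDbar` (gen 103: at a state with `mlog v_{k+1}(X(u)) = h(u)` on the (S1) fibre, `dbavgCovIter L W (relPert W X(u)) (k+1) = 1`
and `φ̃(u) = coarseDatumNL L k W U′ u = QbarIter L (k+1) W X(u)`) and `NE7DbarQbarLetters.directLetter_L1_of_dbar` ∕ `directLetter_L2_of_dbar` (gen 98: [B8]'s two k-free letters, tree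
`Spine/NE3/…B8` ∕ `NE7QbarIterL1DbarFree` ∕ `NE7QbarIterL2DbarFree`, read under `hdbar` alone, in the currency `‖X‖_w = energyNormW`, whose bond term `M⁻²·dirSq X` absorbs `l2sq X` — no
slice Poincaré).  This is hDL′ of `NE7HintOfDirectLettersSU2FM.hint_SU2_of_directLetters_fm` AT THE (R1″) REPRESENTATIVE — the polygon of FINDING-1 is gone because the datum is the
DOUBLE-bar linearised average (the representative satisfies (1.37) exactly), not the single-bar one.
WHAT ([folklore]; 0 def, 0 sorry).  **`directLetter_L1_nl0`**, **`directLetter_L2_nl0`** (hypotheses: the tower class at `W` with [B7]'s Prop-4 regime at the radius `b ≥ sup‖X(u)‖` in [B8]'s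
shape — `C0·2α₀ ≤ 1∕3`, `8α₀ ≤ c2′`, `4Mb ≤ c3`, `16K·Mb ≤ √(L²∕L^d)`, the ℓ¹ level line `hS1`, `2048d·Mb ≤ 1` —, the (S1) fibre `cavgIter (k+1) U′ = cavgIter (k+1) W` with `U′`'s class data,
the state's chart ∕ corners ∕ `‖X‖ ≤ 1∕8` and **`∀ z, mlog v_{k+1}(X(u)) z = h(u) z`**).
HONEST FRAMING (page 1): composition of landed kernel theorems; nothing of Bałaban's asserted; the END (`R₀`'s ℓ-letters for `Ñ⋆ = R₀ φ̃⋆`, the junction to `hdecomp♭`, the END currency) open;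
NE7 NOT proved; spine 0∕9; finite T⁴ rung (B)+1 — NOT infinite volume, NOT mass gap, NOT BetaPertH, NOT Clay.  Continuum YM on T⁴ ⇐ BetaPertH ∧ nine spine estimates (0/9 proved).
-/

set_option autoImplicit false

open scoped BigOperators Matrix.Norms.L2Operator
open NormedSpace Finset

namespace Summit.QuantumFields.BalabanUV.T4Continuum.NE7SliceDirectLettersNL0

open Literature.MathematicalPhysics.QuantumFieldTheory.Balaban1983to89
open B7Prop1Explicit B7Prop2Explicit B7Prop3Flat MatrixLog
open B7Eq92Concrete (vcov dbavgCovIter)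
open T4AveragingDeficitWall (IsUnitaryCfg IsSkewDir SmallField vary dirL1 dirSq)
open T4AveragingDeficitWallBoundary (IsPeriodicCfg periodBox)
open AveragingDeficitPeriodicCounting (IsPeriodicDir)
open AveragingDeficitMultiLevelPrep (cavgIter LevelSmall tower)
open NE3EnergyShapes (IsUnitarySite IsPeriodicSite)
open NE3TangentCovariantTower (QbarIter)
open NE3FramePotBoundW (tower_eq_pow_mul)
open NE3.PairLandauB8Avg (relPert)
open ReplicationRightInverseBound (radSum)
open BlockAverageVaryHolo (nbRad)
open NE3CovariantLineSumsError (Csup)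
open ShellMeasureAverageProp4General (C1cov)
open NE3EnergyWeightedShapes (energyNormW)
open NE7SliceIterationState (repLog cornerLog)
open NE7SliceIterationStateNL (coarseDatumNL)
open NE7SliceIterationStateFacts (repLog_periodic)
open NE7SliceRepresentativeDbar (dbavgCovIter_eq_one_of_mlog_vcov_eq coarseDatumNL_eq_QbarIter_of_mlog_vcov_eq)
open NE7DbarQbarLetters (directLetter_L1_of_dbar directLetter_L2_of_dbar)

noncomputable section

variable {d : ℕ} {n : Type*} [Fintype n] [DecidableEq n] [Nonempty n]

section Letters

variable {L N : ℕ} (hL : 2 ≤ L) [NeZero N] (k : ℕ) {W : Site d → Fin d → (Matrix n n ℂ)ˣ} {x : ℝ} (hWu : IsUnitaryCfg W)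
  (hWP : IsPeriodicCfg W ((tower L N (k + 1) : ℕ) : ℤ)) (hx : 0 ≤ x) (hs : LevelSmall d L k x) (hWx : SmallField W x)
  -- [B7]'s Prop-4 regime at the radius `b`, in [B8]'s shape
  {α₀ b : ℝ} (hα : 0 < α₀) (hα3 : C0 d * (2 * α₀) ≤ 1 / 3) (hα4 : 4 * (2 * α₀) ≤ c2' d L) (h52 : pdev W < α₀ * (((L : ℝ) ^ (k + 1))⁻¹) ^ 2) (hb : 0 ≤ b)
  (hsmall : Real.exp (4 * (800 * ((d : ℝ) + 1) ^ 2 * ((d : ℝ) + 4)) * α₀) * (1 + 8 * (131072 * ((d : ℝ) + 1) ^ 2) * ((L : ℝ) ^ (k + 1) * b)) ≤ 2)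
  (hc₃ : 4 * ((L : ℝ) ^ (k + 1) * b) ≤ c3 d L) (hsm : 2048 * (d : ℝ) * ((L : ℝ) ^ (k + 1) * b) ≤ 1)
  (hK : 16 * (C1cov d * (L : ℝ) ^ 2 * Real.sqrt (d * (2 * (2 * L) + 1) ^ d)) * (L : ℝ) ^ (k + 1) * b ≤ Real.sqrt ((L : ℝ) ^ 2 / (L : ℝ) ^ d))
  -- the target configuration on the (S1) fibre, with its class data
  (U' : Site d → Fin d → (Matrix n n ℂ)ˣ) (hU'u : IsUnitaryCfg U') (hU'P : IsPeriodicCfg U' ((tower L N (k + 1) : ℕ) : ℤ))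
  {x' : ℝ} (hx'0 : 0 ≤ x') (hs' : LevelSmall d L k x') (hU'x : SmallField U' x') (htop : cavgIter L (k + 1) U' = cavgIter L (k + 1) W)
  -- the state: unitary periodic, chart, corners, sizes, and (1.37) EXACTLY
  {u : Site d → (Matrix n n ℂ)ˣ} (hu : IsUnitarySite u) (huP : IsPeriodicSite u ((tower L N (k + 1) : ℕ) : ℤ))
  (hgauge : gaugeAct u U' = vary W (repLog W U' u) 1) (hX8 : ∀ y κ, ‖repLog W U' u y κ‖ ≤ 1 / 8) (hXb : ∀ y κ, ‖repLog W U' u y κ‖ ≤ b)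
  (hcorner : ∀ z, ((u (((L : ℤ) ^ (k + 1)) • z) : (Matrix n n ℂ)ˣ) : Matrix n n ℂ) = exp (cornerLog L k u z))
  (hv0 : ∀ z, mlog ((vcov L W (relPert W (repLog W U' u)) (k + 1) z : (Matrix n n ℂ)ˣ) : Matrix n n ℂ) = cornerLog L k u z)

include hL hWu hα hα4 h52 hb hXb hsmall hc₃ hsm hv0 hU'u hx'0 hs' hU'x htop hu hgauge hcorner in
/-- [B8]'s `hdbar` at the state (the α-lines of the letters imply those of `NE7SliceRepresentativeDbar`). [folklore] -/
theorem hdbar_nl0 (hα3 : C0 d * (2 * α₀) ≤ 1 / 3) : dbavgCovIter L W (relPert W (repLog W U' u)) (k + 1) = 1 := by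
  have hC : 0 ≤ C0 d := by unfold C0; positivity
  have hα3' : C0 d * α₀ ≤ 1 / 3 := by nlinarith
  have hα4' : 4 * α₀ ≤ c2' d L := by linarith
  have hM0 : 0 ≤ (L : ℝ) ^ (k + 1) * b := by positivity
  have hc₃' : 2 * ((L : ℝ) ^ (k + 1) * b) ≤ c3 d L := by linarith
  exact dbavgCovIter_eq_one_of_mlog_vcov_eq hL k hWu U' hα hα3' hα4' h52 hb hXb hsmall hc₃' hsm hv0 hU'u hx'0 hs' hU'x htop hu hgauge hcorner

include hL hWu hWP hx hs hWx hα hα3 hα4 h52 hb hsmall hc₃ hsm hK hU'u hU'P hx'0 hs' hU'x htop hu huP hgauge hX8 hXb hcorner hv0 in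
/-- **(DL1) AT THE (R1″) REPRESENTATIVE**: `(M^d∕M⁴)·dirL1 φ̃(u) [0,N)^d ≤ (64C₁L²d(4L+1)^d·(L^d∕L²))·‖X(u)‖_w²` (plus the ℓ¹ level line `hS1`, `1 ≤ N`). [folklore] -/
theorem directLetter_L1_nl0 (hN : 1 ≤ N)
    (hS1 : (16 * (d + 1) * (d + 4) * (L : ℝ) ^ 2 * Csup d L * (d * (2 * nbRad d L + 1) ^ d)) * radSum d L k x ≤ ((L : ℝ) / (L : ℝ) ^ d) / 2) :
    ((L : ℝ) ^ (k + 1)) ^ d / ((L : ℝ) ^ (k + 1)) ^ 4 * dirL1 (coarseDatumNL L k W U' u) (periodBox (d := d) N)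
      ≤ (64 * (C1cov d * (L : ℝ) ^ 2 * (d * (2 * (2 * (L : ℝ)) + 1) ^ d)) * ((L : ℝ) ^ d / (L : ℝ) ^ 2))
          * energyNormW L (k + 1) W (repLog W U' u) (periodBox (d := d) (N * L ^ (k + 1))) ^ 2 := by
  have hT : (tower L N (k + 1) : ℕ) = N * L ^ (k + 1) := by rw [tower_eq_pow_mul, Nat.mul_comm]
  have hWP' : IsPeriodicCfg W ((N * L ^ (k + 1) : ℕ) : ℤ) := by rw [← hT]; exact hWP
  have hXP : IsPeriodicDir (repLog W U' u) ((N * L ^ (k + 1) : ℕ) : ℤ) := fun y i μ => by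
    rw [← hT]; exact repLog_periodic k N U' hWP hU'P huP y i μ
  rw [coarseDatumNL_eq_QbarIter_of_mlog_vcov_eq hL k hWu hx hs hWx N U' hWP hU'u hU'P hu huP hgauge hX8 hv0]
  exact directLetter_L1_of_dbar hL hN k hWu hWP' hx hs hWx hα hα3 hα4 h52 hb hXb hXP hsmall hc₃ hK hS1
    (hdbar_nl0 hL k hWu hα hα4 h52 hb hsmall hc₃ hsm U' hU'u hx'0 hs' hU'x htop hu hgauge hXb hcorner hv0 hα3)

include hL hWu hWP hx hs hWx hα hα3 hα4 h52 hb hsmall hc₃ hsm hK hU'u hU'P hx'0 hs' hU'x htop hu huP hgauge hX8 hXb hcorner hv0 in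
/-- **(DL2) AT THE (R1″) REPRESENTATIVE**: `(M^d∕M⁴)·dirSq φ̃(u) [0,N)^d ≤ (1024K²(L^d∕L⁴)·(M·b)²)·‖X(u)‖_w²`, `K = C₁L²√(d(4L+1)^d)` (`1 ≤ N`). [folklore] -/
theorem directLetter_L2_nl0 (hN : 1 ≤ N) :
    ((L : ℝ) ^ (k + 1)) ^ d / ((L : ℝ) ^ (k + 1)) ^ 4 * dirSq (coarseDatumNL L k W U' u) (periodBox (d := d) N)
      ≤ (1024 * (C1cov d * (L : ℝ) ^ 2 * Real.sqrt (d * (2 * (2 * L) + 1) ^ d)) ^ 2 * ((L : ℝ) ^ d / (L : ℝ) ^ 4) * ((L : ℝ) ^ (k + 1) * b) ^ 2)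
          * energyNormW L (k + 1) W (repLog W U' u) (periodBox (d := d) (N * L ^ (k + 1))) ^ 2 := by
  have hT : (tower L N (k + 1) : ℕ) = N * L ^ (k + 1) := by rw [tower_eq_pow_mul, Nat.mul_comm]
  have hWP' : IsPeriodicCfg W ((N * L ^ (k + 1) : ℕ) : ℤ) := by rw [← hT]; exact hWP
  have hXP : IsPeriodicDir (repLog W U' u) ((N * L ^ (k + 1) : ℕ) : ℤ) := fun y i μ => by
    rw [← hT]; exact repLog_periodic k N U' hWP hU'P huP y i μ
  rw [coarseDatumNL_eq_QbarIter_of_mlog_vcov_eq hL k hWu hx hs hWx N U' hWP hU'u hU'P hu huP hgauge hX8 hv0]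
  exact directLetter_L2_of_dbar hL hN k hWu hWP' hx hs hWx hα hα3 hα4 h52 hb hXb hXP hsmall hc₃ hK
    (hdbar_nl0 hL k hWu hα hα4 h52 hb hsmall hc₃ hsm U' hU'u hx'0 hs' hU'x htop hu hgauge hXb hcorner hv0 hα3)

end Letters

end

end Summit.QuantumFields.BalabanUV.T4Continuum.NE7SliceDirectLettersNL0
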